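import Summits.ResolutionOfSingularities.ResolutionOfSingularities.Theorems.FrobeniusClosingCampaignW41Core4HahnValues
import Literature.AlgebraicGeometry.Resolution.MuPTorsorLocalUniformizationRelative
import Literature.AlgebraicGeometry.Resolution.LocalBlowup
import Literature.AlgebraicGeometry.Resolution.RankOneReductionProofs
import Mathlib.Algebra.CharP.Lemmas
import Mathlib.RingTheory.KrullDimension.Basic
import HarnessLib

/-!
# Steer σ-residual, §σ2.20 NORMALISED START — (N0) `Concl` is generator-free and (N2) the core-datum rows transport
# under `(A₀, t) ↦ (A₀[1/b], (t − G)/H)`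

OURS (campaign res-hironaka, rung L, slot W4.1, crux `Steer` stmt-ResolutionOfSingularities-16345; res-L0-w41-plan-1
RULING 7 2026-08-27T07:54:40Z (N0)+(N2), DEAL RULINGS 8–12 07:55:08Z «pv-012 → §σ2.20 (N0)+(N2)»; defs of record =
res-L0-w41-strat-2 delta rev 11 `NormalAt` / `NormalisedStartTwo`). Theses-free and definition-free: every row of the
skeleton's `CoreDatum` that mentions the torsor datum is transported by its own lemma, with the row UNFOLDED; the
skeleton leaf destructures `core : CoreDatum p 4 k K O A₀ h₀ t` and reassembles `CoreDatum p 4 k K O A₁ h₁ t₁`.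
AI-produced; weaker than expert review; nothing here is a statement of the manuscript under review.

Setting. `k ⊆ K` fields, `O` a valuation ring of `K`, `A₀ ⊆ O` a `k`-subalgebra, `R := locAtCentre A₀ O` its local ring
at the centre.  A normalisation step replaces the torsor generator `t` (`t ^ p ∈ A₀`) by `t₁ := (t − G) / H` where
`G H U ∈ R`, `H ≠ 0`, `t ^ p = G ^ p + H ^ p · U` (so `t₁ ^ p = U` in characteristic `p`), and `A₀` by
`A₁ := A₀[1/b]` for a common denominator `b ∈ A₀` of `G, H, U` which is a unit at the centre.  The one identity
everything rides on: `locAtCentre A₁ O = locAtCentre A₀ O` (`locAtCentre_eq_of_le_of_le`).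

* `locAtCentre_eq_of_le_of_le`, `exists_adjoinInv_model` (the model `A₁ ∋ G, H, U`, finitely generated, inside `O`,
  same local ring at the centre);
* (N0) `concl_of_pow_mem` — from ANY finitely generated regular model `A ⊇ A₀` inside `O` with `Frac A = K` one gets
  one containing `t` (`t ^ p ∈ A₀`; regular ⇒ normal: the tree's `exists_model_adjoin_of_mem_adjoin`);
* (N2) rows: `isRegularLocalRing_centre_of_locAtCentre_eq`, `ringKrullDim_centre_eq_of_locAtCentre_eq`, the maximal
  row by `isMaximal_centre_of_zeroDim'`, `pow_normalisedGen_eq` / `isFractionRing_adjoin_normalisedGen`, the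
  non-`p`-th-power row `normalisedGen_pow_ne_pow`, and `concl_of_concl_normalised` (`t = G + H · t₁`).
The remaining rows (`StronglySwitching` / `ArchSeq` / `Defect`, and the derivation row with its X-type exit) are in
the sibling file `FrobeniusClosingSteerNormalStartRows.lean`.
-/

noncomputable section

-- single-problem summit: the doubled namespace component `ResolutionOfSingularities` is forced
set_option linter.dupNamespace false

namespace Summit.ResolutionOfSingularities.ResolutionOfSingularities.Theorems.SwitchingDichotomy.NormalStart

open IsLocalRing
open Literature.AlgebraicGeometry.Resolution

variable {k K : Type} [Field k] [Field K] [Algebra k K]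

/-! ## The local ring at the centre does not see units -/

/-- If `B ≤ B' ≤ B_{𝔪_O ∩ B}` then `B'` and `B` have the same local ring at the centre of `O`
(idempotence and monotonicity of `locAtCentre`). [cite: NovacoskiSpivakovsky2014, Lemma 2.5] -/
theorem locAtCentre_eq_of_le_of_le {B B' : Subring K} (O : ValuationSubring K) (h₁ : B ≤ B')
    (h₂ : B' ≤ locAtCentre B O) : locAtCentre B' O = locAtCentre B O := by
  refine le_antisymm ?_ (locAtCentre_mono O h₁)
  have h := locAtCentre_mono O h₂
  rwa [locAtCentre_locAtCentre] at h

/-- Regularity at the centre only depends on the local ring at the centre. [folklore]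
[cite: NovacoskiSpivakovsky2014, Lemma 2.5] -/
theorem isRegularLocalRing_centre_of_locAtCentre_eq {B B' : Subring K} {O : ValuationSubring K}
    (h : B ≤ O.toSubring) (h' : B' ≤ O.toSubring) (heq : locAtCentre B' O = locAtCentre B O)
    (hreg : IsRegularLocalRing (Localization.AtPrime
      (Ideal.comap (Subring.inclusion h) (maximalIdeal O)))) :
    IsRegularLocalRing (Localization.AtPrime (Ideal.comap (Subring.inclusion h') (maximalIdeal O))) := by
  have h1 : IsRegularLocalRing (locAtCentre B O) := (isRegularLocalRing_locAtCentre_iff h).mpr hreg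
  have h2 : IsRegularLocalRing (locAtCentre B' O) := by rw [heq]; exact h1
  exact (isRegularLocalRing_locAtCentre_iff h').mp h2

/-- The Krull dimension at the centre only depends on the local ring at the centre. [folklore]
[cite: NovacoskiSpivakovsky2014, Lemma 2.5] -/
theorem ringKrullDim_centre_eq_of_locAtCentre_eq {B B' : Subring K} {O : ValuationSubring K}
    (h : B ≤ O.toSubring) (h' : B' ≤ O.toSubring) (heq : locAtCentre B' O = locAtCentre B O) :
    ringKrullDim (Localization.AtPrime (Ideal.comap (Subring.inclusion h') (maximalIdeal O))) =
      ringKrullDim (Localization.AtPrime (Ideal.comap (Subring.inclusion h) (maximalIdeal O))) := by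
  change ringKrullDim (Localization.AtPrime (subringCentre B' O h')) =
    ringKrullDim (Localization.AtPrime (subringCentre B O h))
  rw [ringKrullDim_eq_of_ringEquiv (locAtCentreEquiv h').toRingEquiv,
    ringKrullDim_eq_of_ringEquiv (locAtCentreEquiv h).toRingEquiv]
  -- equal subrings have equal dimension
  have : ∀ {S S' : Subring K}, S' = S → ringKrullDim S' = ringKrullDim S := by
    rintro S S' rfl; rfl
  exact this heq

/-! ## The model `A₀[1/b]` -/

/-- Elements of `k[A, b⁻¹]` lie in the local ring of `A` at the centre when `b ∈ A` is a unit there. [folklore]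
[cite: NovacoskiSpivakovsky2014, Lemma 2.5] -/
theorem adjoin_inv_le_locAtCentre (O : ValuationSubring K) (A : Subalgebra k K) {b : K} (hb : b ∈ A)
    (hvb : O.valuation b = 1) :
    (Algebra.adjoin k (insert b⁻¹ (A : Set K))).toSubring ≤ locAtCentre A.toSubring O := by
  intro x hx
  rw [Algebra.adjoin_eq_ring_closure] at hx
  refine Subring.closure_le.mpr ?_ hx
  rintro z (⟨c, rfl⟩ | hz)
  · exact le_locAtCentre _ O (A.algebraMap_mem c)
  · rcases hz with rfl | hz
    · exact inv_mem_locAtCentre (le_locAtCentre _ O hb) hvb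
    · exact le_locAtCentre _ O hz

/-- **The model `A₁ = A₀[1/b]`.**  For `b ∈ A₀` a unit at the centre of `O`: `A₁ := k[A₀, b⁻¹]` is finitely generated
(if `A₀` is), lies in `O`, contains `A₀` and `b⁻¹`, and has the SAME local ring at the centre. [folklore]
[cite: NovacoskiSpivakovsky2014, Lemma 2.5] -/
theorem adjoinInv_model (O : ValuationSubring K) (A₀ : Subalgebra k K) (h₀ : A₀.toSubring ≤ O.toSubring)
    (hfg : A₀.FG) {b : K} (hb : b ∈ A₀) (hvb : O.valuation b = 1) :
    (Algebra.adjoin k (insert b⁻¹ (A₀ : Set K))).toSubring ≤ O.toSubring ∧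
      A₀ ≤ Algebra.adjoin k (insert b⁻¹ (A₀ : Set K)) ∧ (Algebra.adjoin k (insert b⁻¹ (A₀ : Set K))).FG ∧
      b⁻¹ ∈ Algebra.adjoin k (insert b⁻¹ (A₀ : Set K)) ∧
      locAtCentre (Algebra.adjoin k (insert b⁻¹ (A₀ : Set K))).toSubring O = locAtCentre A₀.toSubring O := by
  classical
  have hle := adjoin_inv_le_locAtCentre O A₀ hb hvb
  have h₁ : (Algebra.adjoin k (insert b⁻¹ (A₀ : Set K))).toSubring ≤ O.toSubring :=
    hle.trans (locAtCentre_le h₀)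
  have hA₀ : A₀ ≤ Algebra.adjoin k (insert b⁻¹ (A₀ : Set K)) :=
    fun x hx => Algebra.subset_adjoin (Set.mem_insert_of_mem _ hx)
  have hFG : (Algebra.adjoin k (insert b⁻¹ (A₀ : Set K))).FG := by
    obtain ⟨s, hs⟩ := hfg
    have : Algebra.adjoin k (insert b⁻¹ (A₀ : Set K)) = Algebra.adjoin k ↑(insert b⁻¹ s) := by
      rw [Finset.coe_insert, ← hs, Algebra.adjoin_insert_adjoin]
    rw [this]
    exact Subalgebra.fg_adjoin_finset _
  exact ⟨h₁, hA₀, hFG, Algebra.subset_adjoin (Set.mem_insert _ _),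
    locAtCentre_eq_of_le_of_le O (show A₀.toSubring ≤ _ from hA₀) hle⟩

/-- A common denominator: finitely many elements of the local ring at the centre lie in some `A₀[1/b]` with `b ∈ A₀`
a unit at the centre (here: three of them, which is what the normalisation step needs). [folklore]
[cite: NovacoskiSpivakovsky2014, Def. 2.8] -/
theorem exists_adjoinInv_mem₃ (O : ValuationSubring K) (A₀ : Subalgebra k K) {G H U : K}
    (hG : G ∈ locAtCentre A₀.toSubring O) (hH : H ∈ locAtCentre A₀.toSubring O)
    (hU : U ∈ locAtCentre A₀.toSubring O) :
    ∃ b : K, b ∈ A₀ ∧ O.valuation b = 1 ∧ G ∈ Algebra.adjoin k (insert b⁻¹ (A₀ : Set K)) ∧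
      H ∈ Algebra.adjoin k (insert b⁻¹ (A₀ : Set K)) ∧ U ∈ Algebra.adjoin k (insert b⁻¹ (A₀ : Set K)) := by
  obtain ⟨g₁, hg₁, g₂, hg₂, hvg, rfl⟩ := hG
  obtain ⟨h₁, hh₁, h₂, hh₂, hvh, rfl⟩ := hH
  obtain ⟨u₁, hu₁, u₂, hu₂, hvu, rfl⟩ := hU
  have hg0 := ne_zero_of_valuation_eq_one hvg
  have hh0 := ne_zero_of_valuation_eq_one hvh
  have hu0 := ne_zero_of_valuation_eq_one hvu
  set b := g₂ * h₂ * u₂ with hbdef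
  have hbA : b ∈ A₀ := A₀.mul_mem (A₀.mul_mem hg₂ hh₂) hu₂
  have hvb : O.valuation b = 1 := by simp [hbdef, hvg, hvh, hvu]
  set A₁ := Algebra.adjoin k (insert b⁻¹ (A₀ : Set K)) with hA₁
  have hA₀A₁ : ∀ {x : K}, x ∈ A₀ → x ∈ A₁ := fun hx => Algebra.subset_adjoin (Set.mem_insert_of_mem _ hx)
  have hbi : b⁻¹ ∈ A₁ := Algebra.subset_adjoin (Set.mem_insert _ _)
  refine ⟨b, hbA, hvb, ?_, ?_, ?_⟩
  · have : g₁ / g₂ = g₁ * (h₂ * u₂) * b⁻¹ := by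
      rw [hbdef]; field_simp
    rw [this]
    exact A₁.mul_mem (A₁.mul_mem (hA₀A₁ hg₁) (A₁.mul_mem (hA₀A₁ hh₂) (hA₀A₁ hu₂))) hbi
  · have : h₁ / h₂ = h₁ * (g₂ * u₂) * b⁻¹ := by
      rw [hbdef]; field_simp
    rw [this]
    exact A₁.mul_mem (A₁.mul_mem (hA₀A₁ hh₁) (A₁.mul_mem (hA₀A₁ hg₂) (hA₀A₁ hu₂))) hbi
  · have : u₁ / u₂ = u₁ * (g₂ * h₂) * b⁻¹ := by
      rw [hbdef]; field_simp
    rw [this]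
    exact A₁.mul_mem (A₁.mul_mem (hA₀A₁ hu₁) (A₁.mul_mem (hA₀A₁ hg₂) (hA₀A₁ hh₂))) hbi

/-! ## (N0) `Concl` is generator-free -/

/-- **(N0) `concl_of_pow_mem`** (plan-1 RULING 7): `Concl O A₀ t` — a finitely generated `A ⊇ A₀` with `t ∈ A ⊆ O`,
`Frac A = K`, regular at the centre of `O` (UNFOLDED) — follows from the existence of ANY finitely generated regular
model `A ⊇ A₀` inside `O` with `Frac A = K`, as soon as `t ^ p ∈ A₀` (`p ≠ 0`): the regular local ring at the centre is
normal, so `t = a / b` with `b` a unit there, and `A[1/b]` is the model (the tree's `exists_model_adjoin_of_mem_adjoin`).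
In particular `Concl O A₀ t₁ → Concl O A₀ t` for ANY `t₁`. [cite: Matsumura1987, Thm. 19.4] -/
theorem concl_of_pow_mem (O : ValuationSubring K) (A₀ : Subalgebra k K) (t : K) {p : ℕ} (hp : p ≠ 0)
    (htp : t ^ p ∈ A₀)
    (h : ∃ (A : Subalgebra k K) (hA : A.toSubring ≤ O.toSubring), A₀ ≤ A ∧ A.FG ∧ IsFractionRing A K ∧
      IsRegularLocalRing (Localization.AtPrime (Ideal.comap (Subring.inclusion hA) (maximalIdeal O)))) :
    ∃ (A : Subalgebra k K) (hA : A.toSubring ≤ O.toSubring), A₀ ≤ A ∧ t ∈ A ∧ A.FG ∧ IsFractionRing A K ∧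
      IsRegularLocalRing (Localization.AtPrime (Ideal.comap (Subring.inclusion hA) (maximalIdeal O))) := by
  obtain ⟨A, hA, hA₀A, hfg, hfr, hreg⟩ := h
  haveI := hfr
  -- `t ∈ Frac A = K`, as an element of the intermediate field generated by `A`
  have htF : t ∈ IntermediateField.adjoin k (A : Set K) := by
    obtain ⟨x, y, -, hxy⟩ := IsFractionRing.div_surjective (A := A) t
    rw [← hxy]
    exact div_mem (IntermediateField.subset_adjoin _ _ x.2) (IntermediateField.subset_adjoin _ _ y.2)
  obtain ⟨A', hA', hAA', htA', hfg', -, hreg'⟩ :=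
    exists_model_adjoin_of_mem_adjoin O A hA hfg hreg htF hp (hA₀A htp)
  exact ⟨A', hA', hA₀A.trans hAA', htA', hfg', isFractionRing_subalgebra_of_le A A' hAA', hreg'⟩

/-! ## (N2) the normalised generator `t₁ = (t − G) / H` -/

/-- `t = G + H · t₁` for `t₁ = (t − G) / H`, `H ≠ 0`. [folklore] [cite: NovacoskiSpivakovsky2014, §3.1] -/
theorem eq_add_mul_normalisedGen {t G H : K} (hH : H ≠ 0) : t = G + H * ((t - G) / H) := by
  field_simp
  ring

/-- In characteristic `p`: if `t ^ p = G ^ p + H ^ p · U` and `H ≠ 0` then `((t − G) / H) ^ p = U`.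
[cite: NovacoskiSpivakovsky2014, §3.1] [folklore] -/
theorem pow_normalisedGen_eq (p : ℕ) [hp : Fact p.Prime] [CharP K p] {t G H U : K} (hH : H ≠ 0)
    (ht : t ^ p = G ^ p + H ^ p * U) : ((t - G) / H) ^ p = U := by
  rw [div_pow, sub_pow_char t G, ht, add_sub_cancel_left, mul_div_cancel_left₀ _ (pow_ne_zero _ hH)]

/-- The normalised datum generates the same field: `k[A₀, t] ≤ k[A₁, t₁]` when `A₀ ≤ A₁ ∋ G, H` and
`t = G + H · t₁`; hence `Frac (k[A₁, t₁]) = K` if `Frac (k[A₀, t]) = K`. [folklore]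
[cite: NovacoskiSpivakovsky2014, §3.1] -/
theorem isFractionRing_adjoin_normalisedGen (A₀ A₁ : Subalgebra k K) (hA : A₀ ≤ A₁) {t G H : K}
    (hG : G ∈ A₁) (hHA : H ∈ A₁) (hH : H ≠ 0)
    (hfr : IsFractionRing (Algebra.adjoin k (insert t (A₀ : Set K))) K) :
    IsFractionRing (Algebra.adjoin k (insert ((t - G) / H) (A₁ : Set K))) K := by
  haveI := hfr
  have hle : Algebra.adjoin k (insert t (A₀ : Set K)) ≤ Algebra.adjoin k (insert ((t - G) / H) (A₁ : Set K)) := by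
    refine Algebra.adjoin_le (Set.insert_subset_iff.mpr ⟨?_, fun x hx => Algebra.subset_adjoin
      (Set.mem_insert_of_mem _ (hA hx))⟩)
    have ht₁ : (t - G) / H ∈ Algebra.adjoin k (insert ((t - G) / H) (A₁ : Set K)) :=
      Algebra.subset_adjoin (Set.mem_insert _ _)
    have hG' : G ∈ Algebra.adjoin k (insert ((t - G) / H) (A₁ : Set K)) :=
      Algebra.subset_adjoin (Set.mem_insert_of_mem _ hG)
    have hH' : H ∈ Algebra.adjoin k (insert ((t - G) / H) (A₁ : Set K)) :=
      Algebra.subset_adjoin (Set.mem_insert_of_mem _ hHA)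
    have hmem : G + H * ((t - G) / H) ∈ Algebra.adjoin k (insert ((t - G) / H) (A₁ : Set K)) :=
      Subalgebra.add_mem _ hG' (Subalgebra.mul_mem _ hH' ht₁)
    rwa [← eq_add_mul_normalisedGen (t := t) (G := G) hH] at hmem
  exact isFractionRing_subalgebra_of_le _ _ hle

/-- **`Concl` descends along the normalisation step**: a regular model for `(A₁, t₁)` is one for `(A₀, t)` when
`A₀ ≤ A₁ ∋ G, H` and `t = G + H · t₁` (cf. res-L0-w41-strat-2's `concl_regenerate`). `Concl` UNFOLDED. [folklore]
[cite: NovacoskiSpivakovsky2014, §3.1] -/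
theorem concl_of_concl_normalised (O : ValuationSubring K) (A₀ A₁ : Subalgebra k K) (hA : A₀ ≤ A₁)
    {t G H : K} (hG : G ∈ A₁) (hHA : H ∈ A₁) (hH : H ≠ 0)
    (h : ∃ (A : Subalgebra k K) (hA' : A.toSubring ≤ O.toSubring), A₁ ≤ A ∧ (t - G) / H ∈ A ∧ A.FG ∧
      IsFractionRing A K ∧
      IsRegularLocalRing (Localization.AtPrime (Ideal.comap (Subring.inclusion hA') (maximalIdeal O)))) :
    ∃ (A : Subalgebra k K) (hA' : A.toSubring ≤ O.toSubring), A₀ ≤ A ∧ t ∈ A ∧ A.FG ∧ IsFractionRing A K ∧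
      IsRegularLocalRing (Localization.AtPrime (Ideal.comap (Subring.inclusion hA') (maximalIdeal O))) := by
  obtain ⟨A, hA', hA₁A, ht₁, hfg, hfr, hreg⟩ := h
  refine ⟨A, hA', hA.trans hA₁A, ?_, hfg, hfr, hreg⟩
  rw [eq_add_mul_normalisedGen (t := t) (G := G) hH]
  exact A.add_mem (hA₁A hG) (A.mul_mem (hA₁A hHA) ht₁)

/-- **The non-`p`-th-power row transports.**  If `t` is not in the local ring `R = locAtCentre A₀ O` — which is what
the core datum's row «`t ^ p ≠ c ^ p` for every `c` of the local ring at the centre» says in characteristic `p` — then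
neither is `t₁ = (t − G)/H` for `G, H ∈ R`, `H ≠ 0`; stated as: `t₁ ∈ R → t ∈ R`. [folklore]
[cite: NovacoskiSpivakovsky2014, §3.1] -/
theorem mem_locAtCentre_of_normalisedGen_mem (O : ValuationSubring K) (A₀ : Subalgebra k K) {t G H : K}
    (hG : G ∈ locAtCentre A₀.toSubring O) (hHR : H ∈ locAtCentre A₀.toSubring O) (hH : H ≠ 0)
    (h : (t - G) / H ∈ locAtCentre A₀.toSubring O) : t ∈ locAtCentre A₀.toSubring O := by
  rw [eq_add_mul_normalisedGen (t := t) (G := G) hH]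
  exact Subring.add_mem _ hG (Subring.mul_mem _ hHR h)

/-- In characteristic `p`, `x ^ p = c ^ p` forces `x = c`. [folklore] [cite: Matsumura1987, §26] -/
theorem eq_of_pow_eq_pow_char (p : ℕ) [hp : Fact p.Prime] [CharP K p] {x c : K} (h : x ^ p = c ^ p) : x = c := by
  have : (x - c) ^ p = 0 := by rw [sub_pow_char x c, h, sub_self]
  exact sub_eq_zero.mp (pow_eq_zero_iff hp.out.ne_zero |>.mp this)

/-- **The non-`p`-th-power row, in the skeleton's `Localization.AtPrime` form.**  Let `R₀`, `R₁` be the local rings of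
`A₀`, `A₁` at the centre (abstract localisations), with `locAtCentre A₁ O = locAtCentre A₀ O`, `G H ∈ locAtCentre A₀ O`,
`H ≠ 0`, `t ^ p ∈ A₀`, `t₁ := (t − G)/H` with `t₁ ^ p ∈ A₁`.  If `t ^ p` is not a `p`-th power in `R₀` then `t₁ ^ p` is
not a `p`-th power in `R₁`. [folklore] [cite: NovacoskiSpivakovsky2014, §3.1] -/
theorem normalisedGen_pow_ne_pow (p : ℕ) [hp : Fact p.Prime] [CharP K p] (O : ValuationSubring K)
    (A₀ A₁ : Subalgebra k K) (h₀ : A₀.toSubring ≤ O.toSubring) (h₁ : A₁.toSubring ≤ O.toSubring)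
    (heq : locAtCentre A₁.toSubring O = locAtCentre A₀.toSubring O) {t G H : K}
    (hG : G ∈ locAtCentre A₀.toSubring O) (hHR : H ∈ locAtCentre A₀.toSubring O) (hH : H ≠ 0)
    (htp : t ^ p ∈ A₀) (ht₁p : ((t - G) / H) ^ p ∈ A₁)
    (hc : ∀ c : Localization.AtPrime (Ideal.comap (Subring.inclusion h₀) (maximalIdeal O)),
      algebraMap A₀.toSubring _ ⟨t ^ p, htp⟩ ≠ c ^ p) :
    ∀ c : Localization.AtPrime (Ideal.comap (Subring.inclusion h₁) (maximalIdeal O)),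
      algebraMap A₁.toSubring _ ⟨((t - G) / H) ^ p, ht₁p⟩ ≠ c ^ p := by
  intro c hcc
  -- read the equation in `K` through `e₁ : R₁ ≃ locAtCentre A₁ O`
  let L₁ := Localization.AtPrime (subringCentre A₁.toSubring O h₁)
  let e₁ : L₁ ≃ₐ[A₁.toSubring] locAtCentre A₁.toSubring O := locAtCentreEquiv h₁
  have hcomm₁ : ∀ y : A₁.toSubring, ((e₁ (algebraMap A₁.toSubring L₁ y) : locAtCentre A₁.toSubring O) : K)
      = (y : K) := by
    intro y
    rw [AlgEquiv.commutes]
    rfl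
  have c₁ : {c₁ : L₁ // algebraMap A₁.toSubring L₁ ⟨((t - G) / H) ^ p, ht₁p⟩ = c₁ ^ p} := ⟨c, hcc⟩
  obtain ⟨c₁, hcc'⟩ := c₁
  have h2 : ((t - G) / H) ^ p = ((e₁ c₁ : locAtCentre A₁.toSubring O) : K) ^ p := by
    have h3 := congrArg (fun z : L₁ => ((e₁ z : locAtCentre A₁.toSubring O) : K)) hcc'
    simp only [map_pow] at h3
    rw [hcomm₁] at h3
    simpa using h3
  have ht₁ : (t - G) / H = (e₁ c₁ : K) := eq_of_pow_eq_pow_char p h2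
  -- so `t₁`, hence `t`, lies in the local ring at the centre of `A₀`
  have ht₁R : (t - G) / H ∈ locAtCentre A₀.toSubring O := by rw [ht₁, ← heq]; exact (e₁ c₁).2
  have htR : t ∈ locAtCentre A₀.toSubring O := mem_locAtCentre_of_normalisedGen_mem O A₀ hG hHR hH ht₁R
  -- pull back through `e₀ : R₀ ≃ locAtCentre A₀ O`
  let L₀ := Localization.AtPrime (subringCentre A₀.toSubring O h₀)
  let e₀ : L₀ ≃ₐ[A₀.toSubring] locAtCentre A₀.toSubring O := locAtCentreEquiv h₀
  have hx : (⟨t, htR⟩ : locAtCentre A₀.toSubring O) ^ p =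
      algebraMap A₀.toSubring (locAtCentre A₀.toSubring O) ⟨t ^ p, htp⟩ :=
    Subtype.ext (by simp [locAtCentre.algebraMap_apply])
  refine hc (e₀.symm ⟨t, htR⟩) ?_
  change algebraMap A₀.toSubring L₀ ⟨t ^ p, htp⟩ = (e₀.symm ⟨t, htR⟩) ^ p
  rw [← map_pow, hx, AlgEquiv.commutes]

end Summit.ResolutionOfSingularities.ResolutionOfSingularities.Theorems.SwitchingDichotomy.NormalStart

end
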